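import Literature.AlgebraicGeometry.ShimuraVarieties.UnitaryBallCauchyRiemann
import HarnessLib

/-!
# `𝔭 ⊂ [𝔲(2,1), 𝔲(2,1)]`: every `X_b` is a bracket with the central element of `𝔨`

For the standard parametrisation `X_b = [[0, b], [bᴴ, 0]]` (`BallForms.pMat`) of `𝔭 ⊂ 𝔲(2,1)` and the
element `Z₀ = diag(i, i, -i)/2` of the centre of `𝔨 = 𝔲(2) ⊕ 𝔲(1)` we record the 3 × 3 identity
`[Z₀, X_c] = X_{ic}`, hence `X_b = [Z₀, X_{-ib}]`: `𝔭 = [Z₀, 𝔭] ⊂ [𝔲(2,1), 𝔲(2,1)]`. Consequence used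
downstream (with `RealMatrixGroup.differential_lie`): the differential of a continuous character of
`U(2,1)` vanishes on `𝔭`, so character twists of archimedean Weil data do not move the
`𝔭₋`-annihilation slopes of harmonic vectors. Knapp, *Lie Groups Beyond an Introduction*, VI.§2
(Cartan decomposition of `𝔲(p,q)`; `ad` of the centre of `𝔨` on `𝔭`). [Knapp2002]
-/

namespace Literature.AlgebraicGeometry.ShimuraVarieties

namespace BallForms

open scoped Matrix ComplexConjugate
open Literature.Geometry.ComplexHyperbolic
open Literature.Geometry.ComplexHyperbolic.BallModel

/-- The element `Z₀ = diag(i, i, -i)/2` of `𝔨 = 𝔲(2) ⊕ 𝔲(1) ⊂ 𝔲(2,1)`: together with the centre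
`iℝ·1` of `𝔲(2,1)` it spans the centre of `𝔨`, and `ad Z₀` acts on `𝔭` with eigenvalues `±i`
(`zCenter_mul_pMat_sub`: `[Z₀, X_c] = X_{ic}`), hence invertibly — which is why `𝔭 = [Z₀, 𝔭]`.
Knapp, VI.§2. [folklore] -/
noncomputable def zCenter : Matrix (Fin 3) (Fin 3) ℂ :=
  Matrix.diagonal ![Complex.I / 2, Complex.I / 2, -(Complex.I / 2)]

/-- `Z₀ ∈ 𝔲(2,1)`: `Z₀ᴴ J + J Z₀ = 0`. [folklore] -/
theorem zCenter_skew : zCenterᴴ * J + J * zCenter = 0 := by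
  ext i j
  simp only [zCenter, J, Matrix.diagonal_conjTranspose, Matrix.diagonal_mul_diagonal,
    Matrix.add_apply, Matrix.zero_apply, Matrix.diagonal_apply]
  fin_cases i <;> fin_cases j <;> simp [Complex.conj_I] <;> ring

/-- **`[Z₀, X_c] = X_{ic}`** as matrices. [folklore] -/
theorem zCenter_mul_pMat_sub (c : Fin 2 → ℂ) :
    zCenter * pMat c - pMat c * zCenter = pMat (Complex.I • c) := by
  ext i j
  simp only [zCenter, Matrix.sub_apply, Matrix.mul_diagonal, Matrix.diagonal_mul]
  fin_cases i <;> fin_cases j <;> simp [pMat] <;> ring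

/-- **`𝔭 = [Z₀, 𝔭]`**: `X_b = Z₀ X_{-ib} - X_{-ib} Z₀`. [folklore] -/
theorem pMat_eq_bracket_zCenter (b : Fin 2 → ℂ) :
    pMat b = zCenter * pMat (-(Complex.I • b)) - pMat (-(Complex.I • b)) * zCenter := by
  rw [zCenter_mul_pMat_sub, smul_neg, ← mul_smul, Complex.I_mul_I, neg_smul, one_smul, neg_neg]

/-- The same identity as a Lie bracket of matrices (`Ring.lie_def`). [folklore] -/
theorem pMat_eq_lie_zCenter (b : Fin 2 → ℂ) :
    pMat b = ⁅zCenter, pMat (-(Complex.I • b))⁆ := by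
  rw [Ring.lie_def]; exact pMat_eq_bracket_zCenter b

end BallForms

end Literature.AlgebraicGeometry.ShimuraVarieties
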